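import Summits.FinalStateConjecture.FinalStateConjecture.Theorems.TameCensorship.Negative.GenericityScale
import Summits.FinalStateConjecture.FinalStateConjecture.Theorems.TameCensorship.Negative.TameBreathingObservable
import Literature.Geometry.Lorentzian.TameGenericityLocal

/-!
# TAME Christodoulou genericity is not closed under conjunction — on the crux's own admissible class
(negative-side support for crux `TameCensorship`, `stmt-FinalStateConjecture-17431`, route
`PhotonSphereChannels`; cdisprove seat, cycle 4 = first cycle on the re-typed item, 2026-08-17)

The re-typed crux `PhotonSphereChannels.TameCensorship` (rev ≥ 15 of the route file) asserts that ONE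
bundled property `Q` of admissible data — an MGHD exists ∧ every MGHD has complete `𝓘⁺` ∧ no extremal
Kerr remnant ∧ `C³`-bounded outer geometry — is generic in the TAME sense of the summit,
`InitialDataSet.IsTameChristodoulouGeneric (admissibleVacuumData Σ) Q 1`
(`Literature/Geometry/Lorentzian/TameGenericity.lean`): through every exceptional admissible datum
passes an injective one-parameter family of admissible data, tame on one fixed asymptotically flat end
(sole end, Dafermos–Rodnianski rates with continuous mass, `wDist`-continuous at `c = 0`), immersed at
`c = 0`, all of whose other members satisfy `Q`. The literature conjectures the four conjuncts
SEPARATELY generic (weak cosmic censorship; the third law generically, Kehle–Unger; …), and the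
planner's own `why_might_fail` for the item records "(not closed under ∧)".

`GenericityAndFails.lean` / `GenericityScale.lean` (cycles 1–2, on the old topology-free body) showed
that the topology-free notion `IsChristodoulouGeneric` is not closed under conjunction on a MODEL class
(`univ` on the data of the Minkowski slice, modifying `k` by affine — non-decaying — tensors). That
model says nothing about the TAME notion (its escape families are not asymptotically flat) nor about
the ADMISSIBLE class (its members violate the constraints). This file closes both gaps at once:

* `Tame.isTameChristodoulouGeneric_PV`, `Tame.isTameChristodoulouGeneric_QH`: two properties `PV`, `QH`
  of initial data on `Σ = ℝ³` (`Minkowski.slice`), each TAME-Christodoulou-generic with codimension `1`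
  RELATIVE TO THE CRUX'S OWN CLASS `admissibleVacuumData Minkowski.slice`;
* `Tame.not_hasCodimAtLeastIn_PV_and_QH`: the exceptional set of `PV ∧ QH` has codimension ZERO in
  Christodoulou's scale — `HasCodimAtLeastIn 𝓓 {¬(PV ∧ QH)} m` fails for every `m ≥ 1`, hence so do
  `IsChristodoulouGeneric` and, a fortiori, `IsTameChristodoulouGeneric`
  (`Tame.not_isTameChristodoulouGeneric_PV_and_QH`);
* `not_isTameChristodoulouGeneric_and_of_admissible`: **the glue principle
  "`P`, `Q` tame-generic ⇒ `P ∧ Q` tame-generic" is FALSE on `admissibleVacuumData ℝ³` with the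
  summit's notion and the summit's codimension `1`**; `isTameChristodoulouGeneric_and_fails_admissible`
  packages the witnesses.

## The model (everything inside the admissible class; bookkeeping in `TameBreathingObservable.lean`)

Observable: `u(D, z) = h₁₁(z)`, the `(e₀, e₀)` chart component of the metric of `D` in the chart of the
standard end `trivialAFEnd` of `ℝ³`, read at the two points `z₁ = 4e₀`, `z₂ = −4e₀`; the observable
plane point is `Φ(D) = (u(D, z₁) − 1, u(D, z₂) − 1)`, so `Φ(trivialData) = 0` (`hCoeff_trivialAFEnd`).
Motions: the BREATHING CURVES of the tree (`AFEndBreathingData`, `TameBreathingCurve`: pull-backs of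
`D` along compactly supported diffeomorphisms dilating a coordinate ball by `1 + σ(t)`) centred at `z₁`
resp. `z₂` multiply `u(D, z₁)` resp. `u(D, z₂)` by `(1 + σ t)²` (`breatheFamily_h_inner_center`) and
leave the other coordinate unchanged (the balls are disjoint) — horizontal resp. vertical motions in
the observable plane. These curves consist of ADMISSIBLE data (isometric copies: constraints,
completeness and the flat sole end are preserved, `breatheCurve_mem_admissibleVacuumData`), are jointly
smooth, injective, immersed at `0`, and TAME on a collar of the datum's own sole end
(`isTameDataFamily_restrict_of_agree_off_compact_one`: they agree with `D` off a compact set).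
Exceptional sets: concentric SQUARES `maxᵢ |Φᵢ| = 1/(n+1)` around `Φ(trivialData) = 0`, split into
`sideV` = origin ∪ vertical sides (`|Φ₁| = 1/(n+1) ≥ |Φ₂|`) and `sideH` = horizontal sides; `PV` /
`QH` = "`Φ(D)` avoids `sideV` / `sideH`" (membership in the sets `goodV` / `goodH`). A point on a
vertical side is moved off all vertical sides by a small horizontal motion, the origin by any vertical motion, a point on a horizontal side by a small
vertical motion (`Tame.escape`: the side lengths `1/(n+1)` are isolated), and locality in the parameter
is enough (`isTameChristodoulouGeneric_of_local`). But the union of the squares traps every continuous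
curve through `0` by the intermediate value theorem applied to `max |Φᵢ|`
(`not_hasCodimAtLeastIn_of_trap` of `GenericityScale.lean`).

## Consequence for the crux (information for provers and planners)

`TameCensorship` cannot be obtained by proving tame genericity of its conjuncts one at a time and
"gluing": a proof must produce, through each exceptional datum, ONE tame curve escaping the exceptional
sets of MGHD-existence, of complete `𝓘⁺`, of the third law and of outer tameness SIMULTANEOUSLY (or
work with an intersection-stable genericity, which the summit does not use). The refuted strengthening is
exactly the tacit lemma of every "WCC, then third law, then tameness" plan. Nothing here bears on the
truth of the crux itself.

Christodoulou, CQG 16 (1999) A23, p. A24; Ann. Math. 149 (1999) 183, p. 187 (genericity by positive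
codimension in a fixed space of data). Everything is proved (no `sorry`, no new definitions of
mathematical content beyond the model's bookkeeping `def`s).
-/

set_option linter.dupNamespace false
set_option linter.dupNamespace false

noncomputable section

open Set Function Filter Metric TopologicalSpace
open scoped Manifold ContDiff Topology

namespace Summit.FinalStateConjecture.FinalStateConjecture.Theorems.TameCensorship.Negative

open Literature.Geometry.Lorentzian

namespace Tame

/-! ### Elementary real bookkeeping: the side lengths `rad n = 1/(n+1)` are isolated -/

/-- `rad n − rad (n+1) = 1/((n+1)(n+2))`. -/
theorem rad_sub_rad_succ (n : ℕ) :
    rad n - rad (n + 1) = 1 / (((n : ℝ) + 1) * ((n : ℝ) + 2)) := by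
  unfold rad
  push_cast
  field_simp
  ring

/-- The gap between consecutive side lengths is positive. -/
theorem gap_pos (n : ℕ) : 0 < rad n - rad (n + 1) := by
  rw [rad_sub_rad_succ]; positivity

/-- `rad` is strictly decreasing. -/
theorem rad_strictAnti : StrictAnti rad := by
  intro m n h
  unfold rad
  apply one_div_lt_one_div_of_lt
  · positivity
  · exact_mod_cast Nat.add_lt_add_right h 1

/-- The gaps are strictly decreasing. -/
theorem gap_strictAnti {m n : ℕ} (h : m < n) : rad n - rad (n + 1) < rad m - rad (m + 1) := by
  rw [rad_sub_rad_succ, rad_sub_rad_succ]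
  apply one_div_lt_one_div_of_lt
  · positivity
  · have h' : (m : ℝ) + 1 ≤ (n : ℝ) := by exact_mod_cast Nat.succ_le_of_lt h
    nlinarith

/-- The gap is at most half the side length. -/
theorem gap_le_half (n : ℕ) : rad n - rad (n + 1) ≤ rad n / 2 := by
  rw [rad_sub_rad_succ]
  unfold rad
  rw [div_div]
  apply one_div_le_one_div_of_le
  · positivity
  · nlinarith [(Nat.cast_nonneg n : (0 : ℝ) ≤ n), sq_nonneg ((n : ℝ) + 1)]

/-- **Escape lemma.** A number `a'` different from `a`, `|a| = rad n`, but closer to it than the gap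
`rad n − rad (n+1)` is non-zero and its absolute value is no side length `rad m`. -/
theorem escape {n : ℕ} {a a' : ℝ} (ha : |a| = rad n) (hne : a' ≠ a)
    (hlt : |a' - a| < rad n - rad (n + 1)) : a' ≠ 0 ∧ ∀ m : ℕ, |a'| ≠ rad m := by
  have hgap2 := gap_le_half n
  have hradn := rad_pos n
  have hlt' := abs_sub_lt_iff.mp hlt
  -- `a` and `a'` have the same sign, so `|a'| ≠ |a|` and `a' ≠ 0`
  have hsign : (0 < a ∧ 0 < a') ∨ (a < 0 ∧ a' < 0) := by
    rcases le_or_gt 0 a with ha0 | ha0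
    · rw [abs_of_nonneg ha0] at ha
      left
      exact ⟨by linarith, by linarith⟩
    · rw [abs_of_neg ha0] at ha
      right
      exact ⟨ha0, by linarith⟩
  have hne' : |a'| ≠ |a| := by
    intro h
    rcases hsign with ⟨h1, h2⟩ | ⟨h1, h2⟩
    · rw [abs_of_pos h2, abs_of_pos h1] at h
      exact hne h
    · rw [abs_of_neg h2, abs_of_neg h1] at h
      exact hne (neg_injective h)
  have ha'0 : a' ≠ 0 := by
    rcases hsign with ⟨-, h2⟩ | ⟨-, h2⟩
    · exact h2.ne'
    · exact h2.ne
  refine ⟨ha'0, fun m hm ↦ ?_⟩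
  have habs : abs (|a'| - |a|) < rad n - rad (n + 1) :=
    lt_of_le_of_lt (abs_abs_sub_abs_le_abs_sub a' a) hlt
  rw [hm, ha] at habs
  rcases lt_trichotomy m n with hmn | rfl | hmn
  · -- `m < n`: `rad m − rad n ≥ rad m − rad (m+1) > rad n − rad (n+1)`
    have h1 : rad n ≤ rad (m + 1) := rad_strictAnti.antitone (Nat.succ_le_of_lt hmn)
    have h2 := gap_strictAnti hmn
    have h3 : 0 < rad m - rad n := sub_pos.2 (rad_strictAnti hmn)
    rw [abs_of_pos h3] at habs
    linarith
  · exact hne' (by rw [hm, ha])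
  · -- `n < m`: `rad n − rad m ≥ rad n − rad (n+1)`
    have h1 : rad m ≤ rad (n + 1) := rad_strictAnti.antitone (Nat.succ_le_of_lt hmn)
    have h3 : rad m - rad n < 0 := sub_neg.2 (rad_strictAnti hmn)
    rw [abs_of_neg h3] at habs
    linarith

/-! ### The two properties and their tame genericity on the admissible class -/

/-- The origin and the vertical sides of the concentric squares of side lengths `rad n`. -/
def sideV : Set (ℝ × ℝ) := {q | q = 0 ∨ ∃ n : ℕ, |q.1| = rad n ∧ |q.2| ≤ rad n}

/-- The horizontal sides of the concentric squares. -/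
def sideH : Set (ℝ × ℝ) := {q | ∃ n : ℕ, |q.2| = rad n ∧ |q.1| ≤ rad n}

/-- The good set of property `PV`: the observable avoids the origin and the vertical sides. -/
def goodV : Set (InitialDataSet (𝓡 3) Minkowski.slice) := {D | obsPair D ∉ sideV}

/-- The good set of property `QH`: the observable avoids the horizontal sides. -/
def goodH : Set (InitialDataSet (𝓡 3) Minkowski.slice) := {D | obsPair D ∉ sideH}

/-- Membership in `goodV`. -/
theorem mem_goodV {D : InitialDataSet (𝓡 3) Minkowski.slice} : D ∈ goodV ↔ obsPair D ∉ sideV :=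
  Iff.rfl

/-- Membership in `goodH`. -/
theorem mem_goodH {D : InitialDataSet (𝓡 3) Minkowski.slice} : D ∈ goodH ↔ obsPair D ∉ sideH :=
  Iff.rfl

/-- The trivial datum is exceptional for `PV` (so the genericity of `PV` below is not vacuous). -/
theorem trivialData_not_mem_goodV : trivialData ∉ goodV :=
  fun h ↦ (mem_goodV.1 h) (Or.inl obsPair_trivialData)

/-- **`PV` is TAME-Christodoulou-generic (codimension `1`) on the admissible class of `ℝ³`.**
Through an admissible datum whose observable sits at the origin passes the vertical breathing curve
(about `z₂`), off the origin and off every vertical side for all `c ≠ 0`; through one whose observable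
sits on a vertical side passes the horizontal breathing curve (about `z₁`), off `sideV` for small
`c ≠ 0` (`escape`); both are tame admissible injective immersed curves (`curve_witness`), and locality in
the parameter suffices (`isTameChristodoulouGeneric_of_local`). -/
theorem isTameChristodoulouGeneric_PV :
    InitialDataSet.IsTameChristodoulouGeneric 𝓓 (· ∈ goodV) 1 := by
  refine InitialDataSet.isTameChristodoulouGeneric_of_local fun d hd hP ↦ ?_
  have hmem : obsPair d ∈ sideV := not_not.mp (fun h ↦ hP (mem_goodV.2 h))
  rcases hmem with h0 | ⟨n, ha, hb⟩
  · -- the origin: vertical escape, every `c ≠ 0`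
    obtain ⟨E, htame, himm, hzero, hinj, hadm⟩ := curve_witness B₂ hd
    refine ⟨E, curve B₂ d, htame, himm, hzero, hinj, hadm, 1, one_pos, fun c hc _ ↦ ?_⟩
    have h1 : obs d z₁ - 1 = 0 := congrArg Prod.fst h0
    have h2 : obs d z₂ - 1 = 0 := congrArg Prod.snd h0
    have hu : obs d z₂ = 1 := by linarith
    have hne := moved_ne B₂ (u := 1) one_pos hc
    show obsPair (curve B₂ d c) ∉ sideV
    rw [obsPair_curve₂, h1, hu]
    rintro (h | ⟨m, hm, -⟩)
    · exact hne (by simpa using congrArg Prod.snd h)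
    · exact (rad_pos m).ne' (by simpa using hm.symm)
  · -- a vertical side: horizontal escape, small `c ≠ 0`
    obtain ⟨E, htame, himm, hzero, hinj, hadm⟩ := curve_witness B₁ hd
    obtain ⟨δ, hδ, hclose⟩ := exists_delta_moved B₁ (obs d z₁) (gap_pos n)
    refine ⟨E, curve B₁ d, htame, himm, hzero, hinj, hadm, δ, hδ, fun c hc hcδ ↦ ?_⟩
    have hne := moved_ne B₁ (obs_pos d R_lt_z₁) hc
    obtain ⟨hne0, hrad⟩ := escape ha hne (hclose c hcδ)
    show obsPair (curve B₁ d c) ∉ sideV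
    rw [obsPair_curve₁]
    rintro (h | ⟨m, hm, -⟩)
    · exact hne0 (by simpa using congrArg Prod.fst h)
    · exact hrad m hm

/-- **`QH` is TAME-Christodoulou-generic (codimension `1`) on the admissible class of `ℝ³`**
(horizontal sides are escaped by small vertical motions). -/
theorem isTameChristodoulouGeneric_QH :
    InitialDataSet.IsTameChristodoulouGeneric 𝓓 (· ∈ goodH) 1 := by
  refine InitialDataSet.isTameChristodoulouGeneric_of_local fun d hd hQ ↦ ?_
  have hmem : obsPair d ∈ sideH := not_not.mp (fun h ↦ hQ (mem_goodH.2 h))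
  obtain ⟨n, hb, ha⟩ := hmem
  obtain ⟨E, htame, himm, hzero, hinj, hadm⟩ := curve_witness B₂ hd
  obtain ⟨δ, hδ, hclose⟩ := exists_delta_moved B₂ (obs d z₂) (gap_pos n)
  refine ⟨E, curve B₂ d, htame, himm, hzero, hinj, hadm, δ, hδ, fun c hc hcδ ↦ ?_⟩
  have hne := moved_ne B₂ (obs_pos d R_lt_z₂) hc
  obtain ⟨-, hrad⟩ := escape hb hne (hclose c hcδ)
  show obsPair (curve B₂ d c) ∉ sideH
  rw [obsPair_curve₂]
  rintro ⟨m, hm, -⟩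
  exact hrad m hm
/-! ### The conjunction has codimension zero -/

/-- **The exceptional set of `PV ∧ QH` has codimension ZERO inside the admissible class**: it fails
`HasCodimAtLeastIn 𝓓 … m` for every `m ≥ 1` — every jointly smooth family of admissible data through
the trivial datum meets it again off `0` (level-set trap of `GenericityScale.lean` for the observable
`max |Φᵢ|`, whose zero set is the origin and whose level sets at `rad n` are the squares). -/
theorem not_hasCodimAtLeastIn_PV_and_QH {m : ℕ} (hm : m ≠ 0) :
    ¬ InitialDataSet.HasCodimAtLeastIn 𝓓 {d ∈ 𝓓 | ¬ (d ∈ goodV ∧ d ∈ goodH)} m := by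
  refine not_hasCodimAtLeastIn_of_trap hm (f := fun D ↦ max |obs D z₁ - 1| |obs D z₂ - 1|)
    ?_ (d := trivialData) ?_ ?_ ?_ ?_
  · intro F hF γ hγ
    have h1 := (continuous_obs_family hF R_lt_z₁).comp hγ.continuous
    have h2 := (continuous_obs_family hF R_lt_z₂).comp hγ.continuous
    exact ((h1.sub continuous_const).abs).max ((h2.sub continuous_const).abs)
  · exact ⟨trivialData_mem_admissibleVacuumData, fun h ↦ h.1 (Or.inl obsPair_trivialData)⟩
  · simp [obs_trivialData]
  · intro d' hd' h0
    refine ⟨hd', fun h ↦ h.1 (Or.inl ?_)⟩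
    have h1 : |obs d' z₁ - 1| ≤ 0 := h0 ▸ le_max_left _ _
    have h2 : |obs d' z₂ - 1| ≤ 0 := h0 ▸ le_max_right _ _
    have e1 : obs d' z₁ - 1 = 0 := abs_nonpos_iff.mp h1
    have e2 : obs d' z₂ - 1 = 0 := abs_nonpos_iff.mp h2
    show (obs d' z₁ - 1, obs d' z₂ - 1) = 0
    rw [e1, e2]
    rfl
  · intro ε hε
    obtain ⟨n, hn⟩ := exists_nat_one_div_lt hε
    refine ⟨rad n, rad_pos n, hn, fun d' hd' hlev ↦ ⟨hd', fun h ↦ ?_⟩⟩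
    rw [abs_of_nonneg (le_max_of_le_left (abs_nonneg _))] at hlev
    rcases le_total |obs d' z₂ - 1| |obs d' z₁ - 1| with hle | hle
    · rw [max_eq_left hle] at hlev
      exact h.1 (Or.inr ⟨n, hlev, hlev ▸ hle⟩)
    · rw [max_eq_right hle] at hlev
      exact h.2 ⟨n, hlev, hlev ▸ hle⟩

/-- **`PV ∧ QH` is not TAME-Christodoulou-generic, for any codimension parameter `m ≥ 1`** (nor
generic in the topology-free sense: the failure is of `HasCodimAtLeastIn` itself). -/
theorem not_isTameChristodoulouGeneric_PV_and_QH {m : ℕ} (hm : m ≠ 0) :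
    ¬ InitialDataSet.IsTameChristodoulouGeneric 𝓓 (fun D ↦ D ∈ goodV ∧ D ∈ goodH) m :=
  fun h ↦ not_hasCodimAtLeastIn_PV_and_QH hm h.isChristodoulouGeneric

end Tame

/-- **The glue principle is false for the summit's notion on the crux's class.** On
`admissibleVacuumData ℝ³` there are properties `P`, `Q` each TAME-Christodoulou-generic with
codimension `1` (`InitialDataSet.IsTameChristodoulouGeneric … 1`, the notion and the scale of
`FinalStateConjecture` and of `PhotonSphereChannels.TameCensorship`) whose conjunction is not.
Consequence for the crux: `TameCensorship` bundles MGHD-existence, complete `𝓘⁺`, the third law and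
outer tameness into ONE tame-generic property; it does not follow from the tame genericity of the four
conjuncts separately — a proof must build one tame curve escaping all exceptional sets at once. -/
theorem not_isTameChristodoulouGeneric_and_of_admissible :
    ¬ ∀ P Q : InitialDataSet (𝓡 3) Minkowski.slice → Prop,
        InitialDataSet.IsTameChristodoulouGeneric (admissibleVacuumData Minkowski.slice) P 1 →
        InitialDataSet.IsTameChristodoulouGeneric (admissibleVacuumData Minkowski.slice) Q 1 →
        InitialDataSet.IsTameChristodoulouGeneric (admissibleVacuumData Minkowski.slice)
          (fun D ↦ P D ∧ Q D) 1 :=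
  fun h ↦ Tame.not_isTameChristodoulouGeneric_PV_and_QH one_ne_zero
    (h _ _ Tame.isTameChristodoulouGeneric_PV Tame.isTameChristodoulouGeneric_QH)

/-- **Witness form, all codimensions.** Two TAME-generic (codimension `1`) properties of admissible
data on `ℝ³` whose conjunction fails `IsTameChristodoulouGeneric … m` AND the topology-free
`IsChristodoulouGeneric … m` for every `m ≥ 1` (its exceptional set has codimension zero); the
exceptional set of the first property is nonempty (it contains the trivial datum). -/
theorem isTameChristodoulouGeneric_and_fails_admissible :
    ∃ P Q : InitialDataSet (𝓡 3) Minkowski.slice → Prop,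
      InitialDataSet.IsTameChristodoulouGeneric (admissibleVacuumData Minkowski.slice) P 1 ∧
      InitialDataSet.IsTameChristodoulouGeneric (admissibleVacuumData Minkowski.slice) Q 1 ∧
      (trivialData ∈ admissibleVacuumData Minkowski.slice ∧ ¬ P trivialData) ∧
      ∀ m ≠ 0,
        ¬ InitialDataSet.IsTameChristodoulouGeneric (admissibleVacuumData Minkowski.slice)
            (fun D ↦ P D ∧ Q D) m ∧
        ¬ InitialDataSet.IsChristodoulouGeneric (admissibleVacuumData Minkowski.slice)
            (fun D ↦ P D ∧ Q D) m :=
  ⟨(· ∈ Tame.goodV), (· ∈ Tame.goodH), Tame.isTameChristodoulouGeneric_PV,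
    Tame.isTameChristodoulouGeneric_QH, ⟨trivialData_mem_admissibleVacuumData, Tame.trivialData_not_mem_goodV⟩,
    fun _ hm ↦ ⟨Tame.not_isTameChristodoulouGeneric_PV_and_QH hm,
      Tame.not_hasCodimAtLeastIn_PV_and_QH hm⟩⟩

end Summit.FinalStateConjecture.FinalStateConjecture.Theorems.TameCensorship.Negative

end
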